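import Summits.QuantumFields.YangMills.Theorems.LuscherReductionTwistedTraceScalingBOCoreTransfer
import HarnessLib

/-!
# THE CENTRAL QUASIMODE WITHOUT THE FIBRE MEASURE: smearing the input slow point and un-disintegrating
# (lane A of S-BASE, crux `TwistedTraceScaling` stmt-QuantumFields-20203, C4-CORE, the (OD) pen; steps (C1a)+(C1b) of `pub/ym-fleet/ym-luscher-20007-p1/COARSE-DESIGN.md` §27.8)

Everything in (B-OD) is now reduced (`…BOCoreTransfer`) to the CENTRAL transfer `T₁(v') = fpFibreTransfer β Ω W (oT 1 v') 1`, an integral against the fibre measure `π = orthoTransverse`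
(defined by Haar uniqueness, no density in the tree).  This file removes `π` from the problem:
* ★★ `central_transfer_smeared_two_sided` (C1a) — the transport is exact in the INPUT slow point as well: at the output point `oT 1 v'` (`δ = 0`) and for every bounded measurable
  `χ₀ ≥ 0` supported in the `δu`-window, `e^{−η₀}·T₁(v')·I₀ ≤ S_{χ₀}(v') ≤ e^{η₀}·T₁(v')·I₀` with the SMEARED transfer `S_{χ₀}(v') = ∫_u χ₀(u)·fpFibreTransfer β Ω W (oT 1 v') u du`, the
  one-site normaliser `I₀ = ∫_u χ₀(u)K₁(1,u)/K₁(1,1) du` and `η₀ = coreEta L β 0 δu T R Γ σ + coreEps1 L β 0 T R + coreEps2 L β 0 T R σ`: the SHAPE of `T₁` in `v'` is the shape of `S_{χ₀}`;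
* ★★★ `smeared_fpFibreTransfer_eq` (C1b) — UN-DISINTEGRATION, exact: `S_{χ₀}(v') = ∫_g W(g)·(∫_V K_β(oT 1 v', V^g)·boFun χ₀ Ω (V) dμ(V)) dg` with `μ = configMeasure SU2 L` the PRODUCT HAAR
  measure on the links (`integral_configMeasure_orthoTube` read backwards + Fubini) — and ★★ `smeared_fpFibreTransfer_eq_localisedAvg`: `= ∫_V K_β(oT 1 v', V)·(∫_g W(g)·boFun χ₀ Ω (V^{g⁻¹}) dg) dμ(V)`
  (invariance of `μ`), i.e. the plain transfer kernel applied to the `W`-LOCALISED GAUGE AVERAGE of the BO function.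
So (C1) = a Laplace evaluation against product Haar on `SU(2)^E × SU(2)^{sites}`, both with explicit gnomonic densities in the tree (`…GaugeGroupGnChart` with `ι := Edge 3 L` /
`ι := Site 3 L`): (C1c) the localised average of `χ₀⊗Ω_G` ((P) with riders) and (C1d) the Gaussian (`stiff_groundState_stiffGaussExp` on the full `LinkSpace`) — COARSE-DESIGN §27.8.
HONEST FRAMING: exact bookkeeping + one sandwich for a stub of a child of the CONDITIONAL route R2b1; (C1c), (C1d), tails, (B-ST) OPEN; C4-CORE OPEN; not infinite volume, not a gap,
not Clay.
-/

set_option autoImplicit false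

noncomputable section

open MeasureTheory Filter Topology Real
open scoped BigOperators
open Literature.MathematicalPhysics.QuantumFieldTheory
open Literature.MathematicalPhysics.QuantumLattice

namespace Summit.QuantumFields.YangMills.Theorems.FemtoTransferGap.TwoLattice.ConstTube

open Summit.QuantumFields.YangMills.Theorems.FemtoTransferGap
open Summit.QuantumFields.YangMills.Theorems.FemtoTransferGap.TwoLattice
open Summit.QuantumFields.YangMills.Theorems.FemtoTransferGap.TwoLattice.Avg
open Summit.QuantumFields.YangMills.Theorems.FemtoTransferGap.TwoLattice.Stiff (LinkSpace)

variable {L : ℕ} [NeZero L]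

/-! ## §1 Joint measurability in the input slow point -/

omit [NeZero L] in
/-- `(u, v) ↦ orthoTube L u v` is jointly measurable. [folklore] -/
theorem measurable_orthoTube_uncurry : Measurable fun p : GaugeConfig 3 1 SU2 × (Edge 3 L → Fin 3 → ℝ) => orthoTube L p.1 p.2 := by
  haveI : SecondCountableTopology SU2 := secondCountableTopology_su2
  refine measurable_pi_lambda _ fun e => ?_
  simp only [orthoTube]
  exact (continuous_chartSU2.measurable.comp ((measurable_pi_apply e).comp measurable_snd)).mul ((measurable_pi_apply _).comp measurable_fst)

/-- The integrand `(u, (v, g)) ↦ W(g)·K_β(U, (orthoTube u v)^g)·Ω(v̂)` is jointly measurable. [folklore] -/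
theorem measurable_fpFibreTransfer_integrand_uncurry (β : ℝ) {Ω : LinkSpace L → ℝ} (hΩ : Measurable Ω) {W : (Site 3 L → SU2) → ℝ} (hW : Measurable W)
    (U : GaugeConfig 3 L SU2) :
    Measurable fun q : GaugeConfig 3 1 SU2 × ((Edge 3 L → Fin 3 → ℝ) × (Site 3 L → SU2)) =>
      W q.2.2 * transferKernel su2Rep β U (gaugeTransform q.2.2 (orthoTube L q.1 q.2.1)) * Ω (linkEmbed L q.2.1) := by
  haveI : SecondCountableTopology SU2 := secondCountableTopology_su2
  have hK : Measurable fun p : GaugeConfig 3 L SU2 × GaugeConfig 3 L SU2 => transferKernel su2Rep β p.1 p.2 :=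
    (continuous_transferKernel su2Rep continuous_su2Rep β).measurable
  have h2 : Measurable fun q : GaugeConfig 3 1 SU2 × ((Edge 3 L → Fin 3 → ℝ) × (Site 3 L → SU2)) => gaugeTransform q.2.2 (orthoTube L q.1 q.2.1) := by
    have ha : Measurable fun q : GaugeConfig 3 1 SU2 × ((Edge 3 L → Fin 3 → ℝ) × (Site 3 L → SU2)) => (orthoTube L q.1 q.2.1, q.2.2) :=
      ((measurable_orthoTube_uncurry (L := L)).comp (measurable_fst.prodMk (measurable_fst.comp measurable_snd))).prodMk (measurable_snd.comp measurable_snd)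
    have h := (measurable_gaugeAction (L := L)).comp ha
    simpa only [Function.comp_def] using h
  have h3 : Measurable fun q : GaugeConfig 3 1 SU2 × ((Edge 3 L → Fin 3 → ℝ) × (Site 3 L → SU2)) => transferKernel su2Rep β U (gaugeTransform q.2.2 (orthoTube L q.1 q.2.1)) := by
    have hc : Measurable fun _ : GaugeConfig 3 1 SU2 × ((Edge 3 L → Fin 3 → ℝ) × (Site 3 L → SU2)) => U := measurable_const
    have h := hK.comp (hc.prodMk h2); simpa only [Function.comp_def] using h
  exact ((hW.comp (measurable_snd.comp measurable_snd)).mul h3).mul (hΩ.comp ((measurable_linkEmbed L).comp (measurable_fst.comp measurable_snd)))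

/-- `u ↦ fpFibreTransfer β Ω W U u` is measurable. [folklore] -/
theorem measurable_fpFibreTransfer_slow (β : ℝ) {Ω : LinkSpace L → ℝ} (hΩ : Measurable Ω) {W : (Site 3 L → SU2) → ℝ} (hW : Measurable W) (U : GaugeConfig 3 L SU2) :
    Measurable fun u : GaugeConfig 3 1 SU2 => fpFibreTransfer L β Ω W U u := by
  haveI := isFiniteMeasure_orthoTransverse L
  have h := ((measurable_fpFibreTransfer_integrand_uncurry β hΩ hW U).stronglyMeasurable.integral_prod_right'
    (ν := (orthoTransverse L).prod (gaugeMeasure L))).measurable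
  unfold fpFibreTransfer
  simpa only using h

/-! ## §2 ★★ (C1a) The central transfer, smeared in the input slow point -/

/-- ★★ **(C1a) THE SMEARED CENTRAL TRANSFER SANDWICHES `T₁`.**  See the module docstring. [cite: Luscher1983, §3] -/
theorem central_transfer_smeared_two_sided {β : ℝ} (hβ : 0 ≤ β) {Ω : LinkSpace L → ℝ} (hΩm : Measurable Ω) {CΩ : ℝ} (hCΩ : ∀ x, |Ω x| ≤ CΩ) (hΩ0 : ∀ x, 0 ≤ Ω x)
    {W : (Site 3 L → SU2) → ℝ} (hW : Measurable W) {CW : ℝ} (hCW : ∀ g, |W g| ≤ CW) (hW0 : ∀ g, 0 ≤ W g)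
    {δu T R Γ σ : ℝ} (hδu1 : δu ≤ 1) (hT : T ≤ 1 / 30) (hσ0 : 0 ≤ σ) (hσ : σ < 2)
    (hΩt : ∀ v : Edge 3 L → Fin 3 → ℝ, Ω (linkEmbed L v) ≠ 0 → v ∈ capBalancedSet L ∧ (∀ (e : Edge 3 L) (c : Fin 3), |v e c| ≤ T) ∧ ‖linkEmbed L v‖ ≤ R)
    (hWc : ∀ g : Site 3 L → SU2, W g ≠ 0 → (∀ x, ‖su2Quat (g x) - 1‖ ≤ T) ∧ ‖∑ x, vecPart (g x)‖ ≤ Γ)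
    {χ₀ : GaugeConfig 3 1 SU2 → ℝ} (hχm : Measurable χ₀) {Cχ : ℝ} (hCχ : ∀ u, |χ₀ u| ≤ Cχ) (hχ0 : ∀ u, 0 ≤ χ₀ u)
    (hχw : ∀ u, χ₀ u ≠ 0 → (∀ k : Fin 3, ‖su2Quat (u (0, k)) - 1‖ ≤ δu) ∧ (L : ℝ) ^ 3 * wilsonAction su2Rep u ≤ σ)
    {v' : Edge 3 L → Fin 3 → ℝ} (hv' : v' ∈ capBalancedSet L) (hv'T : ∀ (e : Edge 3 L) (c : Fin 3), |v' e c| ≤ T) (hx' : ‖linkEmbed L v'‖ ≤ R) :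
    Real.exp (-(coreEta L β 0 δu T R Γ σ + coreEps1 L β 0 T R + coreEps2 L β 0 T R σ)) * fpFibreTransfer L β Ω W (orthoTube L 1 v') 1 *
        (∫ u, χ₀ u * (transferKernel su2Rep ((L : ℝ) ^ 3 * β) (1 : GaugeConfig 3 1 SU2) u / transferKernel su2Rep ((L : ℝ) ^ 3 * β) (1 : GaugeConfig 3 1 SU2) 1)
          ∂configMeasure SU2 1) ≤
        ∫ u, χ₀ u * fpFibreTransfer L β Ω W (orthoTube L 1 v') u ∂configMeasure SU2 1 ∧
      ∫ u, χ₀ u * fpFibreTransfer L β Ω W (orthoTube L 1 v') u ∂configMeasure SU2 1 ≤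
        Real.exp (coreEta L β 0 δu T R Γ σ + coreEps1 L β 0 T R + coreEps2 L β 0 T R σ) * fpFibreTransfer L β Ω W (orthoTube L 1 v') 1 *
          (∫ u, χ₀ u * (transferKernel su2Rep ((L : ℝ) ^ 3 * β) (1 : GaugeConfig 3 1 SU2) u / transferKernel su2Rep ((L : ℝ) ^ 3 * β) (1 : GaugeConfig 3 1 SU2) 1)
            ∂configMeasure SU2 1) := by
  haveI : SecondCountableTopology SU2 := secondCountableTopology_su2
  set B : ℝ := (L : ℝ) ^ 3 * β with hB
  set η : ℝ := coreEta L β 0 δu T R Γ σ + coreEps1 L β 0 T R + coreEps2 L β 0 T R σ with hη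
  set T₁ : ℝ := fpFibreTransfer L β Ω W (orthoTube L 1 v') 1 with hT₁
  have hK1 : 0 < transferKernel su2Rep B (1 : GaugeConfig 3 1 SU2) 1 := transferKernel_pos _ _ _ _
  have hT₁0 : 0 ≤ T₁ := fpFibreTransfer_nonneg β hΩ0 hW0 _ _
  have hCχ0 : 0 ≤ Cχ := (abs_nonneg _).trans (hCχ 1)
  -- the slow ratio `ρ(u) = K₁(1,u)/K₁(1,1)` and the integrand `F(u) = χ₀(u)·fpFibreTransfer (oT 1 v') u`
  set ρ : GaugeConfig 3 1 SU2 → ℝ := fun u => transferKernel su2Rep B (1 : GaugeConfig 3 1 SU2) u / transferKernel su2Rep B (1 : GaugeConfig 3 1 SU2) 1 with hρ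
  obtain ⟨M1, hM1⟩ := exists_transferKernel_le su2Rep continuous_su2Rep B (L := 1)
  have hρm : Measurable ρ := by
    have hK : Measurable fun p : GaugeConfig 3 1 SU2 × GaugeConfig 3 1 SU2 => transferKernel su2Rep B p.1 p.2 :=
      (continuous_transferKernel su2Rep continuous_su2Rep B).measurable
    have h1 : Measurable fun u : GaugeConfig 3 1 SU2 => ((1 : GaugeConfig 3 1 SU2), u) := measurable_const.prodMk measurable_id
    exact (hK.comp h1).div_const _
  have hρ0 : ∀ u, 0 ≤ ρ u := fun u => div_nonneg (transferKernel_pos _ _ _ _).le hK1.le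
  have hρb : ∀ u, |χ₀ u * ρ u| ≤ Cχ * (M1 / transferKernel su2Rep B (1 : GaugeConfig 3 1 SU2) 1) := fun u => by
    rw [abs_mul, abs_of_nonneg (hρ0 u)]
    exact mul_le_mul (hCχ u) (div_le_div_of_nonneg_right (hM1 _ _) hK1.le) (hρ0 u) hCχ0
  have hρint : Integrable (fun u => χ₀ u * ρ u) (configMeasure SU2 1) := integrable_of_measurable_abs_le _ (hχm.mul hρm) hρb
  obtain ⟨BF, hBF⟩ := abs_fpFibreTransfer_integrand_le (L := L) β hCΩ hCW (orthoTube L 1 v') (1 : GaugeConfig 3 1 SU2)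
  -- a uniform bound on `fpFibreTransfer (oT 1 v') u` in `u`
  haveI := isFiniteMeasure_orthoTransverse L
  obtain ⟨M, hM⟩ := exists_transferKernel_le su2Rep continuous_su2Rep β (L := L)
  have hCW0 : 0 ≤ CW := (abs_nonneg _).trans (hCW 1)
  have hM0 : 0 ≤ M := (transferKernel_pos su2Rep β (1 : GaugeConfig 3 L SU2) 1).le.trans (hM 1 1)
  have hFb : ∀ u, |fpFibreTransfer L β Ω W (orthoTube L 1 v') u| ≤ CW * M * CΩ * ((orthoTransverse L).prod (gaugeMeasure L)).real Set.univ := by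
    intro u
    unfold fpFibreTransfer
    have hb : ∀ p : (Edge 3 L → Fin 3 → ℝ) × (Site 3 L → SU2),
        |W p.2 * transferKernel su2Rep β (orthoTube L 1 v') (gaugeTransform p.2 (orthoTube L u p.1)) * Ω (linkEmbed L p.1)| ≤ CW * M * CΩ := fun p => by
      rw [abs_mul, abs_mul, abs_of_pos (transferKernel_pos su2Rep β _ _)]
      exact mul_le_mul (mul_le_mul (hCW _) (hM _ _) (transferKernel_pos su2Rep β _ _).le hCW0) (hCΩ _) (abs_nonneg _) (mul_nonneg hCW0 hM0)
    calc |∫ p, W p.2 * transferKernel su2Rep β (orthoTube L 1 v') (gaugeTransform p.2 (orthoTube L u p.1)) * Ω (linkEmbed L p.1) ∂(orthoTransverse L).prod (gaugeMeasure L)|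
        ≤ ∫ p, |W p.2 * transferKernel su2Rep β (orthoTube L 1 v') (gaugeTransform p.2 (orthoTube L u p.1)) * Ω (linkEmbed L p.1)| ∂(orthoTransverse L).prod (gaugeMeasure L) :=
          abs_integral_le_integral_abs
      _ ≤ ∫ _p, CW * M * CΩ ∂(orthoTransverse L).prod (gaugeMeasure L) :=
          integral_mono_of_nonneg (ae_of_all _ fun _ => abs_nonneg _) (integrable_const _) (ae_of_all _ hb)
      _ = CW * M * CΩ * ((orthoTransverse L).prod (gaugeMeasure L)).real Set.univ := by rw [integral_const, smul_eq_mul, Measure.real]; ring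
  have hFint : Integrable (fun u => χ₀ u * fpFibreTransfer L β Ω W (orthoTube L 1 v') u) (configMeasure SU2 1) :=
    integrable_of_measurable_abs_le _ (hχm.mul (measurable_fpFibreTransfer_slow β hΩm hW _))
      (C := Cχ * (CW * M * CΩ * ((orthoTransverse L).prod (gaugeMeasure L)).real Set.univ)) fun u => by
        rw [abs_mul]; exact mul_le_mul (hCχ u) (hFb u) (abs_nonneg _) hCχ0
  -- pointwise sandwich in `u`
  have h11 : ∀ k : Fin 3, ‖su2Quat ((1 : GaugeConfig 3 1 SU2) (0, k)) - 1‖ ≤ 0 := fun k => by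
    rw [show (1 : GaugeConfig 3 1 SU2) (0, k) = 1 from rfl, su2Quat_one, sub_self, norm_zero]
  have hS1 : (L : ℝ) ^ 3 * wilsonAction su2Rep (1 : GaugeConfig 3 1 SU2) ≤ σ := by rw [wilsonAction_one_eq_zero, mul_zero]; exact hσ0
  have hpt : ∀ u, Real.exp (-η) * T₁ * (χ₀ u * ρ u) ≤ χ₀ u * fpFibreTransfer L β Ω W (orthoTube L 1 v') u ∧
      χ₀ u * fpFibreTransfer L β Ω W (orthoTube L 1 v') u ≤ Real.exp η * T₁ * (χ₀ u * ρ u) := by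
    intro u
    by_cases hu : χ₀ u = 0
    · rw [hu]; simp
    · obtain ⟨huw, hSu⟩ := hχw u hu
      have hα : ∀ k : Fin 3, ‖su2Quat ((1 : GaugeConfig 3 1 SU2) (0, k)) - su2Quat (u (0, k))‖ ≤ 0 + δu := fun k => by
        rw [show (1 : GaugeConfig 3 1 SU2) (0, k) = 1 from rfl, su2Quat_one, norm_sub_rev, zero_add]; exact huw k
      have htr := fpFibreTransfer_two_sided_core hβ hΩm hCΩ hΩ0 hW hCW hW0 1 u hv' h11 (by norm_num) hα (by linarith) hT hσ hS1 hSu hv'T hx' hΩt hWc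
      rw [zero_add, ← hB, ← hη] at htr
      have hρu : transferKernel su2Rep B 1 u / transferKernel su2Rep B (1 : GaugeConfig 3 1 SU2) 1 = ρ u := rfl
      rw [hρu] at htr
      constructor
      · calc Real.exp (-η) * T₁ * (χ₀ u * ρ u) = χ₀ u * (Real.exp (-η) * ρ u * T₁) := by ring
          _ ≤ χ₀ u * fpFibreTransfer L β Ω W (orthoTube L 1 v') u := mul_le_mul_of_nonneg_left htr.1 (hχ0 u)
      · calc χ₀ u * fpFibreTransfer L β Ω W (orthoTube L 1 v') u ≤ χ₀ u * (Real.exp η * ρ u * T₁) := mul_le_mul_of_nonneg_left htr.2 (hχ0 u)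
          _ = Real.exp η * T₁ * (χ₀ u * ρ u) := by ring
  -- integrate over `u`
  constructor
  · calc Real.exp (-η) * T₁ * ∫ u, χ₀ u * ρ u ∂configMeasure SU2 1 = ∫ u, Real.exp (-η) * T₁ * (χ₀ u * ρ u) ∂configMeasure SU2 1 := by
          rw [integral_const_mul]
      _ ≤ ∫ u, χ₀ u * fpFibreTransfer L β Ω W (orthoTube L 1 v') u ∂configMeasure SU2 1 := integral_mono (hρint.const_mul _) hFint fun u => (hpt u).1
  · calc ∫ u, χ₀ u * fpFibreTransfer L β Ω W (orthoTube L 1 v') u ∂configMeasure SU2 1 ≤ ∫ u, Real.exp η * T₁ * (χ₀ u * ρ u) ∂configMeasure SU2 1 :=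
          integral_mono hFint (hρint.const_mul _) fun u => (hpt u).2
      _ = Real.exp η * T₁ * ∫ u, χ₀ u * ρ u ∂configMeasure SU2 1 := by rw [integral_const_mul]

/-! ## §3 ★★★ (C1b) Un-disintegration: the smeared transfer is an integral against product Haar on the links -/

/-- ★★★ **(C1b) UN-DISINTEGRATION.**  For bounded measurable `Ω`, `W`, `χ₀` and any configuration `U`:
`∫_u χ₀(u)·fpFibreTransfer β Ω W U u du = ∫_g W(g)·(∫_V K_β(U, V^g)·boFun χ₀ Ω (V) dμ(V)) dg`, `μ = configMeasure SU2 L` (product Haar on the links): the fibre measure `π` is gone.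
[cite: Luscher1983, §3] -/
theorem smeared_fpFibreTransfer_eq (β : ℝ) {Ω : LinkSpace L → ℝ} (hΩm : Measurable Ω) {CΩ : ℝ} (hCΩ : ∀ x, |Ω x| ≤ CΩ)
    {W : (Site 3 L → SU2) → ℝ} (hW : Measurable W) {CW : ℝ} (hCW : ∀ g, |W g| ≤ CW)
    {χ₀ : GaugeConfig 3 1 SU2 → ℝ} (hχm : Measurable χ₀) {Cχ : ℝ} (hCχ : ∀ u, |χ₀ u| ≤ Cχ) (U : GaugeConfig 3 L SU2) :
    ∫ u, χ₀ u * fpFibreTransfer L β Ω W U u ∂configMeasure SU2 1 =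
      ∫ g, W g * (∫ V, transferKernel su2Rep β U (gaugeTransform g V) * boFun L χ₀ Ω V ∂configMeasure SU2 L) ∂gaugeMeasure L := by
  haveI := isFiniteMeasure_orthoTransverse L
  haveI : SecondCountableTopology SU2 := secondCountableTopology_su2
  obtain ⟨M, hM⟩ := exists_transferKernel_le su2Rep continuous_su2Rep β (L := L)
  have hCW0 : 0 ≤ CW := (abs_nonneg _).trans (hCW 1)
  have hCΩ0 : 0 ≤ CΩ := (abs_nonneg _).trans (hCΩ 0)
  have hCχ0 : 0 ≤ Cχ := (abs_nonneg _).trans (hCχ 1)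
  have hM0 : 0 ≤ M := (transferKernel_pos su2Rep β (1 : GaugeConfig 3 L SU2) 1).le.trans (hM 1 1)
  -- the joint integrand on `G₁ × (V × Gg)`
  set H : GaugeConfig 3 1 SU2 × ((Edge 3 L → Fin 3 → ℝ) × (Site 3 L → SU2)) → ℝ := fun q =>
    χ₀ q.1 * (W q.2.2 * transferKernel su2Rep β U (gaugeTransform q.2.2 (orthoTube L q.1 q.2.1)) * Ω (linkEmbed L q.2.1)) with hH
  have hHm : Measurable H := (hχm.comp measurable_fst).mul (measurable_fpFibreTransfer_integrand_uncurry β hΩm hW U)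
  have hHb : ∀ q, |H q| ≤ Cχ * (CW * M * CΩ) := fun q => by
    rw [hH]; dsimp only
    rw [abs_mul, abs_mul, abs_mul, abs_of_pos (transferKernel_pos su2Rep β _ _)]
    exact mul_le_mul (hCχ _) (mul_le_mul (mul_le_mul (hCW _) (hM _ _) (transferKernel_pos su2Rep β _ _).le hCW0) (hCΩ _) (abs_nonneg _) (mul_nonneg hCW0 hM0))
      (mul_nonneg (mul_nonneg (abs_nonneg _) (transferKernel_pos su2Rep β _ _).le) (abs_nonneg _)) hCχ0
  have hHint : Integrable H ((configMeasure SU2 1).prod ((orthoTransverse L).prod (gaugeMeasure L))) := integrable_of_measurable_abs_le _ hHm hHb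
  -- LHS as the product integral, then Fubini the other way round
  have hL : ∫ u, χ₀ u * fpFibreTransfer L β Ω W U u ∂configMeasure SU2 1 = ∫ q, H q ∂(configMeasure SU2 1).prod ((orthoTransverse L).prod (gaugeMeasure L)) := by
    rw [integral_prod _ hHint]
    refine integral_congr_ae (ae_of_all _ fun u => ?_)
    dsimp only
    unfold fpFibreTransfer
    rw [← integral_const_mul]
  rw [hL, integral_prod_symm _ hHint]
  -- now `∫_{(v,g)} ∫_u H`; the inner `u`-integral as a function of `(v,g)`
  set G : (Edge 3 L → Fin 3 → ℝ) × (Site 3 L → SU2) → ℝ := fun p => ∫ u, H (u, p) ∂configMeasure SU2 1 with hG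
  have hGm : Measurable G := by
    have h := (hHm.stronglyMeasurable.integral_prod_left' (μ := configMeasure SU2 1)).measurable
    rw [hG]; simpa only using h
  have hGb : ∀ p, |G p| ≤ Cχ * (CW * M * CΩ) := fun p => by
    rw [hG]; dsimp only
    calc |∫ u, H (u, p) ∂configMeasure SU2 1| ≤ ∫ u, |H (u, p)| ∂configMeasure SU2 1 := abs_integral_le_integral_abs
      _ ≤ ∫ _u, Cχ * (CW * M * CΩ) ∂configMeasure SU2 1 := integral_mono_of_nonneg (ae_of_all _ fun _ => abs_nonneg _) (integrable_const _) (ae_of_all _ fun u => hHb (u, p))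
      _ = Cχ * (CW * M * CΩ) := by simp
  have hGint : Integrable G ((orthoTransverse L).prod (gaugeMeasure L)) := integrable_of_measurable_abs_le _ hGm hGb
  change ∫ p, G p ∂(orthoTransverse L).prod (gaugeMeasure L) = _
  rw [integral_prod_symm _ hGint]
  -- RHS: disintegrate each `V`-integral along the orthographic tube
  refine integral_congr_ae (ae_of_all _ fun g => ?_)
  dsimp only
  have hTg : Measurable fun V : GaugeConfig 3 L SU2 => gaugeTransform g V := by
    have hc : Measurable fun _ : GaugeConfig 3 L SU2 => g := measurable_const
    have h := (measurable_gaugeAction (L := L)).comp (measurable_id.prodMk hc)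
    simpa only [Function.comp_def, id] using h
  have hFm : Measurable fun V => transferKernel su2Rep β U (gaugeTransform g V) * boFun L χ₀ Ω V :=
    ((measurable_transferKernel_left β U).comp hTg).mul (measurable_boFun L hχm hΩm)
  have hFb : ∃ C : ℝ, ∀ V, |transferKernel su2Rep β U (gaugeTransform g V) * boFun L χ₀ Ω V| ≤ C :=
    ⟨M * (Cχ * CΩ), fun V => by
      rw [abs_mul, abs_of_pos (transferKernel_pos su2Rep β _ _)]
      exact mul_le_mul (hM _ _) (abs_boFun_le L hCχ hCΩ V) (abs_nonneg _) hM0⟩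
  have hF0 : ∀ V, V ∉ orthoTubeSet L → transferKernel su2Rep β U (gaugeTransform g V) * boFun L χ₀ Ω V = 0 := fun V hV => by
    rw [boFun_eq_zero_of_not_mem L χ₀ Ω hV, mul_zero]
  rw [integral_configMeasure_orthoTube L hFm hFb hF0, ← integral_const_mul]
  have hcap : ∀ᵐ v ∂orthoTransverse L, v ∈ capBalancedSet L := by rw [ae_iff]; exact orthoTransverse_compl_capBalancedSet L
  refine integral_congr_ae (hcap.mono fun v hv => ?_)
  rw [hG, hH]; dsimp only
  rw [← integral_const_mul]
  refine integral_congr_ae (ae_of_all _ fun u => ?_)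
  dsimp only
  rw [boFun_orthoTube L χ₀ Ω u hv]; ring

/-- ★★ **(C1b′) … = the plain kernel applied to the `W`-LOCALISED GAUGE AVERAGE of the BO function**:
`∫_u χ₀(u)·fpFibreTransfer β Ω W U u du = ∫_V K_β(U, V)·(∫_g W(g)·boFun χ₀ Ω (V^{g⁻¹}) dg) dμ(V)` (invariance of `μ` under gauge transformations + Fubini). [cite: SeilerLNP1982, §3] -/
theorem smeared_fpFibreTransfer_eq_localisedAvg (β : ℝ) {Ω : LinkSpace L → ℝ} (hΩm : Measurable Ω) {CΩ : ℝ} (hCΩ : ∀ x, |Ω x| ≤ CΩ)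
    {W : (Site 3 L → SU2) → ℝ} (hW : Measurable W) {CW : ℝ} (hCW : ∀ g, |W g| ≤ CW)
    {χ₀ : GaugeConfig 3 1 SU2 → ℝ} (hχm : Measurable χ₀) {Cχ : ℝ} (hCχ : ∀ u, |χ₀ u| ≤ Cχ) (U : GaugeConfig 3 L SU2) :
    ∫ u, χ₀ u * fpFibreTransfer L β Ω W U u ∂configMeasure SU2 1 =
      ∫ V, transferKernel su2Rep β U V * (∫ g, W g * boFun L χ₀ Ω (gaugeTransform g⁻¹ V) ∂gaugeMeasure L) ∂configMeasure SU2 L := by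
  haveI : SecondCountableTopology SU2 := secondCountableTopology_su2
  obtain ⟨M, hM⟩ := exists_transferKernel_le su2Rep continuous_su2Rep β (L := L)
  have hCW0 : 0 ≤ CW := (abs_nonneg _).trans (hCW 1)
  have hM0 : 0 ≤ M := (transferKernel_pos su2Rep β (1 : GaugeConfig 3 L SU2) 1).le.trans (hM 1 1)
  rw [smeared_fpFibreTransfer_eq β hΩm hCΩ hW hCW hχm hCχ U]
  -- Step 1: move `g` from the kernel to the BO function (invariance of `μ`)
  have hstep : ∀ g : Site 3 L → SU2, ∫ V, transferKernel su2Rep β U (gaugeTransform g V) * boFun L χ₀ Ω V ∂configMeasure SU2 L =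
      ∫ V, transferKernel su2Rep β U V * boFun L χ₀ Ω (gaugeTransform g⁻¹ V) ∂configMeasure SU2 L := fun g => by
    have hTg : Measurable fun V : GaugeConfig 3 L SU2 => gaugeTransform g⁻¹ V := by
      have hc : Measurable fun _ : GaugeConfig 3 L SU2 => g⁻¹ := measurable_const
      have h := (measurable_gaugeAction (L := L)).comp (measurable_id.prodMk hc)
      simpa only [Function.comp_def, id] using h
    have hF : Measurable fun V => transferKernel su2Rep β U V * boFun L χ₀ Ω (gaugeTransform g⁻¹ V) :=
      (measurable_transferKernel_left β U).mul ((measurable_boFun L hχm hΩm).comp hTg)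
    have h := integral_comp_eq_of_measurePreserving (measurePreserving_gaugeTransform_configMeasure g)
      (F := fun V => transferKernel su2Rep β U V * boFun L χ₀ Ω (gaugeTransform g⁻¹ V)) hF
    rw [← h]
    refine integral_congr_ae (ae_of_all _ fun V => ?_)
    dsimp only
    rw [TT.gaugeTransform_gaugeTransform, inv_mul_cancel, TT.gaugeTransform_one']
  simp_rw [hstep]
  -- Step 2: Fubini `g ↔ V`
  have hJm : Measurable fun p : (Site 3 L → SU2) × GaugeConfig 3 L SU2 => W p.1 * (transferKernel su2Rep β U p.2 * boFun L χ₀ Ω (gaugeTransform p.1⁻¹ p.2)) := by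
    have hb : Measurable fun p : (Site 3 L → SU2) × GaugeConfig 3 L SU2 => boFun L χ₀ Ω (gaugeTransform p.1⁻¹ p.2) := by
      have h := (measurable_boFun L hχm hΩm).comp (measurable_gaugeAction_inv' (L := L))
      simpa only [Function.comp_def] using h
    exact (hW.comp measurable_fst).mul (((measurable_transferKernel_left β U).comp measurable_snd).mul hb)
  have hJb : ∀ p : (Site 3 L → SU2) × GaugeConfig 3 L SU2, |W p.1 * (transferKernel su2Rep β U p.2 * boFun L χ₀ Ω (gaugeTransform p.1⁻¹ p.2))| ≤ CW * (M * (Cχ * CΩ)) :=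
    fun p => by
      rw [abs_mul, abs_mul, abs_of_pos (transferKernel_pos su2Rep β _ _)]
      exact mul_le_mul (hCW _) (mul_le_mul (hM _ _) (abs_boFun_le L hCχ hCΩ _) (abs_nonneg _) hM0)
        (mul_nonneg (transferKernel_pos su2Rep β _ _).le (abs_nonneg _)) hCW0
  have hJint : Integrable (fun p : (Site 3 L → SU2) × GaugeConfig 3 L SU2 => W p.1 * (transferKernel su2Rep β U p.2 * boFun L χ₀ Ω (gaugeTransform p.1⁻¹ p.2)))
      ((gaugeMeasure L).prod (configMeasure SU2 L)) := integrable_of_measurable_abs_le _ hJm hJb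
  have e1 : ∀ g : Site 3 L → SU2, W g * ∫ V, transferKernel su2Rep β U V * boFun L χ₀ Ω (gaugeTransform g⁻¹ V) ∂configMeasure SU2 L =
      ∫ V, W g * (transferKernel su2Rep β U V * boFun L χ₀ Ω (gaugeTransform g⁻¹ V)) ∂configMeasure SU2 L := fun g => by rw [← integral_const_mul]
  simp_rw [e1]
  rw [integral_integral_swap hJint]
  refine integral_congr_ae (ae_of_all _ fun V => ?_)
  dsimp only
  rw [← integral_const_mul]
  refine integral_congr_ae (ae_of_all _ fun g => ?_)
  dsimp only; ring

end Summit.QuantumFields.YangMills.Theorems.FemtoTransferGap.TwoLattice.ConstTube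

end
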